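import Literature.NumberTheory.Irrationality.RivoalZudilin2020.PartialFractionsProofs
import Literature.NumberTheory.Irrationality.RivoalZudilin2020.DenominatorsBricks
import HarnessLib

/-!
# Rivoal–Zudilin 2020, Proposition 1 (ii): the typed real `p_{j,m}` are the rational brick coefficients

Topic `Literature/NumberTheory/Irrationality/RivoalZudilin2020`; proofs-only companion of
`TwoIrrationalOddZetaValues.lean`. Source: T. Rivoal, W. Zudilin, *A note on odd zeta values*, Sém. Lothar.
Combin. **81** (2020) B81b = arXiv:1803.03160 [RivoalZudilin2020], §2 (3), (5): "`p_{j,m} :=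
(1/(A−j)!) (R(t)(t+m)^A)^{(A−j)}_{t=−m} ∈ ℚ`".

The typed coefficient `pCoeff A n j m` is a divided derivative of the REAL function `rfunReg A n m`
(`PartialFractionsProofs.pCoeff_eq_divDeriv`), while the arithmetic of [RivoalZudilin2020, §3] is carried out
over `ℚ` on the brick form `RregBrick A n m` (`DenominatorsBricks.lean`). This file proves the printed
"`∈ ℚ`" in the precise form needed:

* `rfunQ A n` — the rational function `R(t)` of §2 over `ℚ`, `rfun_ratCast` (`R(q) = R_ℚ(q)` for rational `q`);
* `exists_rfunQ_eq_pfEval` — a partial-fraction expansion of `R_ℚ` with RATIONAL coefficients (tree: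
  `Transcendental.exists_pfEval_eq_eval_mul_prod_inv`), `rfun_eq_pfEval_ratCast` — the same expansion holds for
  the real `R` at every real non-pole (both sides are continuous off the poles and agree on the dense set of
  rational non-poles);
* `RregBrick_eq_rfunQ_mul` — off the poles, `RregBrick A n m t = R_ℚ(t)(t+m)^A`;
  `divDeriv_RregBrick_eq_coeff` — the rational coefficients ARE the divided derivatives of the brick form at
  `−m` (the argument of `PartialFractionsProofs.divDeriv_rfunReg_eq_coeff`, run over `ℚ`);
* **`pCoeff_eq_ratCast`**: `pCoeff A n j m = ((divDeriv (A−j) (RregBrick A n m) (−m) : ℚ) : ℝ)` for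
  `A ≥ 15`, `m ≤ n`, `1 ≤ j ≤ A`.

HONEST FRAMING (cells pub-zeta5 / zeta5-irr): systematic search; no irrationality claim unless certified —
identities of rational functions and their Taylor coefficients; nothing here concerns `ζ(5)`.
-/

noncomputable section

open Finset Filter Topology Polynomial
open Literature.Analysis.Calculus
open Literature.NumberTheory.Transcendental
open scoped Nat

namespace Literature.NumberTheory.Irrationality.RivoalZudilin2020

/-! ### The rational function over `ℚ` -/

/-- `R(t) = n!^{A−15} 2^{18n} (2t+n)(t−n)_n^3(t+n+1)_n^3(t−n+½)_{3n}^3/(t)_{n+1}^A` as a function `ℚ → ℚ`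
(the typed real `rfun A n` is its cast, `rfun_ratCast`). [cite: RivoalZudilin2020, §2 (definition of R(t))] -/
def rfunQ (A n : ℕ) (t : ℚ) : ℚ :=
  (n ! : ℚ) ^ (A - 15) * 2 ^ (18 * n) * (2 * t + n) *
      ((∏ i ∈ range n, (t - n + i)) ^ 3 * (∏ i ∈ range n, (t + n + 1 + i)) ^ 3 *
        (∏ i ∈ range (3 * n), (t - n + 1 / 2 + i)) ^ 3) /
    ∏ k ∈ range (n + 1), (t + k) ^ A

/-- `R(q) = R_ℚ(q)` for rational `q` (the source's "`p_{j,m} ∈ ℚ`" starts here: `R` has rational coefficients).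
[cite: RivoalZudilin2020, §2 (3) ("∈ ℚ")] -/
theorem rfun_ratCast (A n : ℕ) (q : ℚ) : rfun A n (q : ℝ) = ((rfunQ A n q : ℚ) : ℝ) := by
  unfold rfun rfunQ
  push_cast
  ring

/-- A partial-fraction expansion of `R_ℚ` with rational coefficients: `deg ≤ 15n+1 < A(n+1)`.
[cite: RivoalZudilin2020, §2 (5) (existence, over ℚ)] -/
theorem exists_rfunQ_eq_pfEval (A n : ℕ) (hA : 15 ≤ A) : ∃ c : ℕ → ℕ → ℚ, ∀ t : ℚ,
    (∀ i ∈ range (n + 1), t + i ≠ 0) → rfunQ A n t = pfEval (range (n + 1)) (fun _ => A) c t := by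
  classical
  set P : ℚ[X] := C ((n ! : ℚ) ^ (A - 15) * 2 ^ (18 * n)) * (C 2 * X + C (n : ℚ)) *
      ((∏ i ∈ range n, (X + C ((i : ℚ) - n))) ^ 3 * (∏ i ∈ range n, (X + C ((n : ℚ) + 1 + i))) ^ 3 *
        (∏ i ∈ range (3 * n), (X + C ((i : ℚ) - n + 1 / 2))) ^ 3) with hP
  set L : List ℕ := (range (n + 1)).toList.flatMap fun i => List.replicate A i with hL
  have hlin : ∀ u : ℚ, (X + C u : ℚ[X]).natDegree ≤ 1 := fun u => (natDegree_X_add_C u).le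
  have hprod : ∀ (k : ℕ) (u : ℕ → ℚ), (∏ i ∈ range k, (X + C (u i) : ℚ[X])).natDegree ≤ k := by
    intro k u
    refine (natDegree_prod_le _ _).trans ?_
    refine (sum_le_sum (g := fun _ => 1) fun i _ => hlin _).trans ?_
    simp
  have hdegP : P.natDegree ≤ 15 * n + 1 := by
    have h0 : (C ((n ! : ℚ) ^ (A - 15) * 2 ^ (18 * n)) * (C 2 * X + C (n : ℚ)) : ℚ[X]).natDegree ≤ 1 :=
      (natDegree_C_mul_le _ _).trans natDegree_linear_le
    have h1 := (natDegree_pow_le (p := ∏ i ∈ range n, (X + C ((i : ℚ) - n))) (n := 3)).trans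
      (Nat.mul_le_mul_left 3 (hprod n fun i => (i : ℚ) - n))
    have h2 := (natDegree_pow_le (p := ∏ i ∈ range n, (X + C ((n : ℚ) + 1 + i))) (n := 3)).trans
      (Nat.mul_le_mul_left 3 (hprod n fun i => (n : ℚ) + 1 + i))
    have h3 := (natDegree_pow_le (p := ∏ i ∈ range (3 * n), (X + C ((i : ℚ) - n + 1 / 2))) (n := 3)).trans
      (Nat.mul_le_mul_left 3 (hprod (3 * n) fun i => (i : ℚ) - n + 1 / 2))
    have h123 := natDegree_mul_le.trans (add_le_add (natDegree_mul_le.trans (add_le_add h1 h2)) h3)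
    refine (natDegree_mul_le.trans (add_le_add h0 h123)).trans ?_
    omega
  have hlen : L.length = (n + 1) * A := by
    rw [hL, List.length_flatMap]
    simp
  have hmem : ∀ i ∈ L, i ∈ range (n + 1) := by
    intro i hi
    rw [hL, List.mem_flatMap] at hi
    obtain ⟨j, hj, hij⟩ := hi
    rw [Finset.mem_toList] at hj
    rwa [(List.mem_replicate.1 hij).2]
  have hcount : ∀ i ∈ range (n + 1), L.count i ≤ A := by
    intro i hi
    rw [hL, List.count_flatMap]
    have hi' := mem_range.1 hi
    simp [Function.comp_def, List.count_replicate]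
    split_ifs <;> omega
  have hdeg : P.natDegree < L.length := by
    rw [hlen]
    have : 15 * n + 1 < (n + 1) * A := by nlinarith
    omega
  obtain ⟨c, hc⟩ := exists_pfEval_eq_eval_mul_prod_inv (range (n + 1)) P L hmem hdeg
  have hR : ∀ t : ℚ, rfunQ A n t = P.eval t * (L.map fun i : ℕ => (t + (i : ℚ))⁻¹).prod := by
    intro t
    have hprodL : (L.map fun i : ℕ => (t + (i : ℚ))⁻¹).prod = ∏ i ∈ range (n + 1), ((t + (i : ℚ))⁻¹) ^ A := by
      rw [hL, List.map_flatMap, List.flatMap_def, List.prod_flatten, List.map_map, ← Finset.prod_map_toList]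
      refine congrArg List.prod (List.map_congr_left fun u _ => ?_)
      simp [List.prod_replicate]
    rw [hprodL, rfunQ, hP]
    simp only [eval_mul, eval_C, eval_add, eval_X, eval_pow, eval_prod]
    rw [div_eq_mul_inv, ← prod_inv_distrib]
    congr 1
    · have e1 : ∏ i ∈ range n, (t + ((i : ℚ) - n)) = ∏ i ∈ range n, (t - n + i) :=
        prod_congr rfl fun i _ => by ring
      have e2 : ∏ i ∈ range (3 * n), (t + ((i : ℚ) - n + 1 / 2)) = ∏ i ∈ range (3 * n), (t - n + 1 / 2 + i) :=
        prod_congr rfl fun i _ => by ring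
      have e3 : ∏ i ∈ range n, (t + ((n : ℚ) + 1 + i)) = ∏ i ∈ range n, (t + n + 1 + i) :=
        prod_congr rfl fun i _ => by ring
      rw [e1, e2, e3]
    · exact prod_congr rfl fun i _ => (inv_pow _ _).symm
  have hPF : IsPF (range (n + 1)) (fun i => L.count i) (rfunQ A n) :=
    ⟨c, fun t ht => (hR t).trans (hc t ht)⟩
  obtain ⟨c', hc'⟩ := hPF.mono hcount
  exact ⟨c', hc'⟩

/-! ### From `ℚ` to `ℝ`: the same expansion for the real `R` -/

/-- The real `R` is continuous off its poles. [cite: RivoalZudilin2020, §2 (R(t) as a rational function)] -/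
theorem continuousAt_rfun (A n : ℕ) {x : ℝ} (hx : ∀ i ∈ range (n + 1), x + i ≠ 0) :
    ContinuousAt (rfun A n) x := by
  unfold rfun
  refine ContinuousAt.div (by fun_prop) (by fun_prop) ?_
  exact prod_ne_zero_iff.2 fun k hk => pow_ne_zero _ (hx k hk)

/-- A cast partial-fraction sum is continuous off the poles. [cite: RivoalZudilin2020, §2 (5)] -/
theorem continuousAt_pfEval_ratCast (n : ℕ) (N : ℕ → ℕ) (c : ℕ → ℕ → ℚ) {x : ℝ}
    (hx : ∀ i ∈ range (n + 1), x + i ≠ 0) :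
    ContinuousAt (pfEval (range (n + 1)) N (fun i s => ((c i s : ℚ) : ℝ))) x := by
  unfold pfEval ContinuousAt
  refine tendsto_finsetSum _ fun i hi => tendsto_finsetSum _ fun s _ => ?_
  exact (continuousAt_const.mul
    (((continuousAt_id.add continuousAt_const).pow s).inv₀ (pow_ne_zero _ (hx i hi)))).tendsto

/-- **The rational expansion holds for the real `R`**: if `R_ℚ = Σ c_{i,s}(t+i)^{−s}` at all rational
non-poles, then `R = Σ c_{i,s}(t+i)^{−s}` at all REAL non-poles (continuity off the poles and density of `ℚ`).
[cite: RivoalZudilin2020, §2 (5)] -/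
theorem rfun_eq_pfEval_ratCast (A n : ℕ) {c : ℕ → ℕ → ℚ}
    (hc : ∀ q : ℚ, (∀ i ∈ range (n + 1), q + i ≠ 0) → rfunQ A n q = pfEval (range (n + 1)) (fun _ => A) c q)
    {t : ℝ} (ht : ∀ i ∈ range (n + 1), t + i ≠ 0) :
    rfun A n t = pfEval (range (n + 1)) (fun _ => A) (fun i s => ((c i s : ℚ) : ℝ)) t := by
  set g : ℝ → ℝ := pfEval (range (n + 1)) (fun _ => A) (fun i s => ((c i s : ℚ) : ℝ)) with hg
  -- the open set of non-poles
  set U : Set ℝ := {x | ∀ i ∈ range (n + 1), x + i ≠ 0} with hU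
  have hUopen : IsOpen U := by
    have : U = ⋂ i ∈ range (n + 1), {x : ℝ | x + i ≠ 0} := by
      ext x; simp [hU]
    rw [this]
    refine isOpen_biInter_finset fun i _ => ?_
    exact isOpen_ne_fun (continuous_id.add continuous_const) continuous_const
  -- agreement on rational points of `U`
  have hrat : ∀ q : ℚ, (q : ℝ) ∈ U → rfun A n q = g q := by
    intro q hq
    have hq' : ∀ i ∈ range (n + 1), (q : ℚ) + i ≠ 0 := by
      intro i hi h
      exact hq i hi (by exact_mod_cast h)
    rw [rfun_ratCast, hc q hq', hg, pfEval, pfEval]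
    push_cast
    rfl
  -- density argument
  by_contra hne
  have htU : t ∈ U := ht
  set V : Set ℝ := U ∩ {x | rfun A n x ≠ g x} with hV
  have hVopen : IsOpen V := by
    rw [isOpen_iff_mem_nhds]
    intro x hx
    have hxU : x ∈ U := hx.1
    have h1 : U ∈ 𝓝 x := hUopen.mem_nhds hxU
    have h2 : {y | rfun A n y ≠ g y} ∈ 𝓝 x := by
      have hcf : ContinuousAt (rfun A n) x := continuousAt_rfun A n hxU
      have hcg : ContinuousAt g x := continuousAt_pfEval_ratCast n _ c hxU
      exact (hcf.sub hcg).eventually_ne (sub_ne_zero.2 hx.2) |>.mono fun y hy => sub_ne_zero.1 hy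
    exact inter_mem h1 h2
  have hVne : V.Nonempty := ⟨t, htU, hne⟩
  obtain ⟨q, hq⟩ := Rat.denseRange_cast.exists_mem_open hVopen hVne
  exact hq.2 (hrat q hq.1)

/-! ### The brick form is `R_ℚ(t)(t+m)^A`, and its divided derivatives are the coefficients -/

/-- `∏_{i<3n} (t−n+½+i)` as three blocks of `n` (the three half-integer bricks). [folklore] -/
private theorem prod_half_blocks' (n : ℕ) (t : ℚ) :
    ∏ i ∈ range (3 * n), (t - n + 1 / 2 + i)
      = (∏ j ∈ range n, (t + ((((-(n : ℤ) : ℤ)) : ℚ) + 1 / 2 + j))) *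
          ((∏ j ∈ range n, (t + (((0 : ℤ) : ℚ) + 1 / 2 + j))) *
            ∏ j ∈ range n, (t + (((n : ℤ) : ℚ) + 1 / 2 + j))) := by
  rw [show 3 * n = n + (n + n) by ring, prod_range_add, prod_range_add]
  congr 1
  · exact prod_congr rfl fun j _ => by push_cast; ring
  · congr 1
    · exact prod_congr rfl fun j _ => by push_cast; ring
    · exact prod_congr rfl fun j _ => by push_cast; ring

/-- Off the poles, `RregBrick A n m t = R_ℚ(t) · (t+m)^A` (`A ≥ 15`, `m ≤ n`).
[cite: RivoalZudilin2020, §3 (proof of Proposition 1 (ii), R(t) = (2t+n)F(t)³G(t)^{A−15})] -/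
theorem RregBrick_eq_rfunQ_mul (A n : ℕ) (hA : 15 ≤ A) {m : ℕ} (hm : m ≤ n) {t : ℚ}
    (ht : ∀ i ∈ range (n + 1), t + i ≠ 0) :
    RregBrick A n m t = rfunQ A n t * (t + m) ^ A := by
  have hf : (n ! : ℚ) ≠ 0 := by exact_mod_cast Nat.factorial_ne_zero n
  have hm' : m ∈ range (n + 1) := mem_range.2 (by omega)
  have htm : t + (m : ℚ) ≠ 0 := ht m hm'
  have hQ : ∏ l ∈ (range (n + 1)).filter (fun l => l ≠ m), (t + (l : ℚ)) ≠ 0 :=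
    prod_ne_zero_iff.2 fun l hl => ht l (mem_filter.1 hl).1
  -- split the full denominator at `m`
  have hsplit : ∏ k ∈ range (n + 1), (t + (k : ℚ)) ^ A
      = (t + m) ^ A * ∏ l ∈ (range (n + 1)).filter (fun l => l ≠ m), (t + (l : ℚ)) ^ A := by
    rw [filter_ne', mul_prod_erase (range (n + 1)) (fun k => (t + (k : ℚ)) ^ A) hm']
  have hA' : A = 15 + (A - 15) := by omega
  rw [RregBrick, Fbrick, Greg_eq n hm, rfunQ, hsplit, prod_half_blocks', prod_pow, prod_inv_distrib]
  set Q := ∏ l ∈ (range (n + 1)).filter (fun l => l ≠ m), (t + (l : ℚ)) with hQdef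
  simp only [polyBrick, halfBrick]
  push_cast
  rw [hA']
  simp only [pow_add, Nat.add_sub_cancel_left, mul_pow, inv_pow]
  have hQA : Q ^ (A - 15) ≠ 0 := pow_ne_zero _ hQ
  field_simp
  ring

/-- **The coefficients are the divided derivatives of the brick form**: if
`R_ℚ = Σ_{i ≤ n} Σ_{s ≤ A} c_{i,s}(t+i)^{−s}` off the poles, then `𝒟_a (RregBrick A n m)(−m) = c_{m,A−a}`
for `m ≤ n`, `a < A` — the printed `p_{j,m} = (1/(A−j)!)(R(t)(t+m)^A)^{(A−j)}_{t=−m}` read over `ℚ`.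
[cite: RivoalZudilin2020, §2 (3) and (5)] -/
theorem divDeriv_RregBrick_eq_coeff (A n : ℕ) (hA : 15 ≤ A) {c : ℕ → ℕ → ℚ}
    (hc : ∀ t : ℚ, (∀ i ∈ range (n + 1), t + i ≠ 0) → rfunQ A n t = pfEval (range (n + 1)) (fun _ => A) c t)
    {m : ℕ} (hm : m ≤ n) {a : ℕ} (ha : a < A) :
    divDeriv a (RregBrick A n m) (-(m : ℚ)) = c m (A - a) := by
  have hm' : m ∈ range (n + 1) := mem_range.2 (by omega)
  set H : ℚ → ℚ := fun t => ∑ i ∈ (range (n + 1)).erase m, ∑ s ∈ Icc 1 A, c i s * ((t + i) ^ s)⁻¹ with hH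
  set F : ℚ → ℚ := fun t => ∑ s ∈ Icc 1 A, c m s * (t - (-(m : ℚ))) ^ (A - s)
    + (t - (-(m : ℚ))) ^ A * H t with hF
  have hHs : ContDiffAt ℚ (⊤ : ℕ∞) H (-(m : ℚ)) := by
    refine ContDiffAt.sum fun i hi => ContDiffAt.sum fun s _ => contDiffAt_const.mul ?_
    have him : i ≠ m := (mem_erase.1 hi).1
    refine ((contDiffAt_id.add contDiffAt_const).pow s).inv ?_
    have : (-(m : ℚ) + i) ≠ 0 := by
      rw [show (-(m : ℚ) + i) = ((i : ℤ) - (m : ℤ) : ℤ) by push_cast; ring]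
      exact_mod_cast sub_ne_zero.2 (by exact_mod_cast him : (i : ℤ) ≠ m)
    simpa using pow_ne_zero s this
  have hterm : ∀ s ∈ Icc 1 A, ContDiffAt ℚ (⊤ : ℕ∞)
      (fun t : ℚ => c m s * (t - (-(m : ℚ))) ^ (A - s)) (-(m : ℚ)) := fun s _ =>
    contDiffAt_const.mul (contDiffAt_sub_pow _ _ _)
  have hFs : ContDiffAt ℚ (⊤ : ℕ∞) F (-(m : ℚ)) :=
    (ContDiffAt.sum fun s hs => hterm s hs).add ((contDiffAt_sub_pow _ _ _).mul hHs)
  -- `RregBrick = F` near `-m`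
  have hGF : RregBrick A n m =ᶠ[𝓝 (-(m : ℚ))] F := by
    refine eventuallyEq_of_nhdsNE (RregBrick_isDInt A n hm 0).contDiffAt.continuousAt
      hFs.continuousAt ?_
    have hev := eventually_ne_poles 0 (n + 1) (m : ℤ)
    simp only [Int.cast_natCast] at hev
    filter_upwards [hev] with t ht
    have ht2 : ∀ i ∈ range (n + 1), t + (i : ℚ) ≠ 0 := fun i hi => by
      have := ht.2 i hi; push_cast at this; simpa using this
    rw [RregBrick_eq_rfunQ_mul A n hA hm ht2, hc t ht2, pfEval, ← add_sum_erase _ _ hm', hF, hH]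
    simp only [sub_neg_eq_add]
    rw [add_mul, sum_mul, mul_comm _ (H t)]
    congr 1
    refine sum_congr rfl fun s hs => ?_
    have hs' := (mem_Icc.1 hs).2
    rw [mul_assoc]
    congr 1
    have hpow : (t + m) ^ A = (t + m) ^ s * (t + m) ^ (A - s) := by
      rw [← pow_add]; congr 1; omega
    rw [hpow, ← mul_assoc, inv_mul_cancel₀ (pow_ne_zero s ht.1), one_mul]
  rw [divDeriv_congr hGF, hF]
  have ha' : ContDiffAt ℚ a (fun t => (t - (-(m : ℚ))) ^ A * H t) (-(m : ℚ)) :=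
    ((contDiffAt_sub_pow _ _ _).mul hHs).of_le (mod_cast le_top)
  rw [divDeriv_fun_add ((ContDiffAt.sum fun s hs => hterm s hs).of_le (mod_cast le_top)) ha',
    divDeriv_sub_pow_mul (hHs.of_le (mod_cast le_top)) A, if_pos ha, add_zero,
    divDeriv_sum fun s hs => (hterm s hs).of_le (mod_cast le_top)]
  simp_rw [divDeriv_const_mul, divDeriv_sub_pow]
  rw [sum_eq_single_of_mem (A - a) (mem_Icc.2 ⟨by omega, by omega⟩)]
  · rw [if_pos (by omega), mul_one]
  · intro s hs hsa
    rw [if_neg (by have := mem_Icc.1 hs; omega), mul_zero]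

/-- **`p_{j,m} ∈ ℚ`, precisely**: for `A ≥ 15`, `m ≤ n`, `1 ≤ j ≤ A`, the typed real coefficient `p_{j,m}` is the
cast of the rational number `𝒟_{A−j}(RregBrick A n m)(−m)` — the divided derivative of the brick form of
`R(t)(t+m)^A` over `ℚ`. [cite: RivoalZudilin2020, §2 (3) ("p_{j,m} := … ∈ ℚ")] -/
theorem pCoeff_eq_ratCast (A n : ℕ) (hA : 15 ≤ A) {m : ℕ} (hm : m ≤ n) {j : ℕ} (hj1 : 1 ≤ j) (hjA : j ≤ A) :
    pCoeff A n j m = ((divDeriv (A - j) (RregBrick A n m) (-(m : ℚ)) : ℚ) : ℝ) := by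
  obtain ⟨c, hc⟩ := exists_rfunQ_eq_pfEval A n hA
  have hm' : m ∈ range (n + 1) := mem_range.2 (by omega)
  have hreal := divDeriv_rfunReg_eq_coeff A n (c := fun i s => ((c i s : ℚ) : ℝ))
    (fun t ht => rfun_eq_pfEval_ratCast A n hc ht) hm' (a := A - j) (by omega)
  have hrat := divDeriv_RregBrick_eq_coeff A n hA hc hm (a := A - j) (by omega)
  rw [pCoeff_eq_divDeriv, hreal, hrat]

end Literature.NumberTheory.Irrationality.RivoalZudilin2020
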